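import Summits.Ventures.YMGap.RobustBall.PerturbedCollar
import HarnessLib

/-!
# Venture YMGap, track ROBUST-BALL — the `ℤ^d` SMOOTHING-LIPSCHITZ lemma for the PERTURBED
# specification: one application of the member's kernel turns a bounded measurable local observable
# into a LIPSCHITZ CYLINDER FUNCTION on the `W`-collar

HONEST FRAMING. WHAT THIS IS: a venture file (cell `pub-ymgap`, track Y2 ROBUST-BALL, seat ds-3),
strong-coupling LATTICE bookkeeping for a MEMBER `N β S_W + W` of the tier-1 `ℤ^d` ball (rb-p1's
`perturbedYM ρ β W supp`). Part 2 of the perturbed twin of the seat's Wilson file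
`Thresholds/ZdSmoothingLipschitz.lean` (part 1 = `PerturbedCollar`): for `SU(N)` at tree coupling `b`,
a link potential `W` with measurable bounded terms whose finite-volume Hamiltonian `H^W_Λ` is
`ℓ`-Lipschitz in each outside link (supplied by the cross load, `PerturbedCollar`), and `F` measurable,
depending only on the links of `Λ`, `|F| ≤ M`:
(1) `γ^W_Λ F` is Lipschitz in every outside link for the Frobenius distance with constant `M · E`,
    `E = (e^{2√N · 2(2(d−1)|b|√N + ℓ)} − 1)/(2√N)` (`isLipBound_specAvg_perturbedYM`: tilt oscillation,
    Georgii 2011 Prop. 8.8; `E = wilsonSmoothLip N d b` at `ℓ = 0`, `smoothLip_zero_eq`);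
(2) hence a joint Lipschitz bound in the entry metric on the `W`-collar
    (`abs_specAvg_perturbedYM_sub_le_mul_dist`, Föllmer interpolation) and
(3) `γ^W_Λ F` is an `IsLipschitzCylinder (fundamentalRep (Fin N))` — the observable class of
    Shen–Zhu–Zhu's Cor. 1.4 and of rb-p1's `PerturbedMassGapAt` — on the `W`-collar with constant
    `#collar · N · M · E` (`isLipschitzCylinder_specAvg_perturbedYM`, McShane), and the support-size form
    `(1 + m) · n · N · M · E` (`…_card`) used for translated observables.
WHAT IT IS NOT: no door, no row, no number of the cell; nothing about the continuum or the Clay problem.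
Consumed by the bridge files `PerturbedMassiveBridge` / `MassGapOnBallMassive`.

References: H.-O. Georgii, Gibbs Measures and Phase Transitions (2011), Def. 1.23, Prop. 8.8;
H. Föllmer, LNM 1362 (1988) Ch. I Remark (2.17); E. J. McShane, Bull. AMS 40 (1934) 837;
H. Shen, R. Zhu, X. Zhu, CMP 400 (2023) 805–851, §4.1 and Cor. 1.4.
-/

noncomputable section

open MeasureTheory ProbabilityTheory Function Finset Filter Topology
open scoped NNReal
open Literature.Probability.LatticeModels
open Literature.Probability.LatticeModels.DobrushinMetric
open Literature.MathematicalPhysics.QuantumLattice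
open Literature.MathematicalPhysics.QuantumFieldTheory hiding ZdEdge
open Literature.MathematicalPhysics.QuantumFieldTheory.Balaban1983to89
open Literature.MathematicalPhysics.QuantumFieldTheory.Balaban1983to89.StrongCouplingTorusWindow
open Summit.Ventures.YMGap.ZdSmoothing

namespace Summit.Ventures.YMGap.RobustBall

variable {d N : ℕ}

/-! ### `SU(N)`: the smoothing is Lipschitz in every outside link; Lipschitz-cylinder conclusion -/

section Lipschitz

variable {W : Potential (ZdEdge d) (Matrix.specialUnitaryGroup (Fin N) ℂ)}
  {supp : Finset (ZdEdge d) → Finset (Finset (ZdEdge d))}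

/-- **The member's `ℤ^d` smoothing is Lipschitz in every outside link** (Georgii 2011, Prop. 8.8, tilt
oscillation; perturbed twin of `ZdSmoothing.isLipBound_specAvg_ymSpecification`): for `SU(N)`, tree
coupling `b`, a link potential `W` with measurable bounded terms whose finite-volume Hamiltonian `H^W_Λ`
is `ℓ`-Lipschitz in every outside link, and `F` measurable inside `Λ` with `|F| ≤ M`,
`|γ^W_Λ F(σ) − γ^W_Λ F(τ)| ≤ M · E · ‖σ_y − τ_y‖_F` whenever `σ = τ` off `y`, with
`E = (e^{2√N · 2(2(d−1)|b|√N + ℓ)} − 1)/(2√N)` (`= wilsonSmoothLip N d b` at `ℓ = 0`). -/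
theorem isLipBound_specAvg_perturbedYM (hN : 1 ≤ N) (b : ℝ) (hWm : ∀ X, Measurable (W X))
    (hWb : ∀ X, ∃ C, ∀ U, |W X U| ≤ C) (Λ : Finset (ZdEdge d)) {ℓ : ℝ} (hℓ : 0 ≤ ℓ)
    (hH : ∀ y, y ∉ Λ → ∀ U V : LGConfig d (Matrix.specialUnitaryGroup (Fin N) ℂ),
      (∀ z, z ≠ y → U z = V z) →
        |hamiltonianIn W supp Λ U - hamiltonianIn W supp Λ V| ≤ ℓ * suFrobDist (U y) (V y))
    {F : LGConfig d (Matrix.specialUnitaryGroup (Fin N) ℂ) → ℝ} (hFm : Measurable F)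
    (hFdep : DependsOn F (↑Λ : Set (ZdEdge d))) {M : ℝ} (hM : ∀ U, |F U| ≤ M) :
    IsLipBound suFrobDist (specAvg (perturbedYM (fundamentalRep (Fin N)) b W supp) Λ F)
      fun _ => M * ((Real.exp (2 * Real.sqrt N *
        (2 * (((2 * (d - 1) : ℕ) : ℝ) * (|b| * Real.sqrt N) + ℓ))) - 1) / (2 * Real.sqrt N)) := by
  classical
  haveI : SecondCountableTopology (Matrix (Fin N) (Fin N) ℂ) :=
    inferInstanceAs (SecondCountableTopology (Fin N → Fin N → ℂ))
  haveI : SecondCountableTopology (Matrix.specialUnitaryGroup (Fin N) ℂ) :=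
    Topology.IsEmbedding.subtypeVal.secondCountableTopology
  have hρc := continuous_fundamentalRep (Fin N)
  have hM0 : 0 ≤ M := (abs_nonneg _).trans (hM fun _ => 1)
  have hN0 : (0 : ℝ) < N := by exact_mod_cast hN
  set D : ℝ := 2 * Real.sqrt N with hDdef
  have hD : 0 < D := by rw [hDdef]; positivity
  set a : ℝ := 2 * (((2 * (d - 1) : ℕ) : ℝ) * (|b| * Real.sqrt N) + ℓ) with ha
  have ha0 : 0 ≤ a := by positivity
  set E : ℝ := (Real.exp (D * a) - 1) / D with hEdef
  have hE0 : 0 ≤ E := div_nonneg (sub_nonneg.2 (Real.one_le_exp (by positivity))) hD.le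
  have hEm : Measurable (perturbedEnergy (fundamentalRep (Fin N)) b W supp Λ) :=
    measurable_perturbedEnergy _ hρc b hWm supp Λ
  obtain ⟨B, hB⟩ := exists_abs_perturbedEnergy_le (fundamentalRep (Fin N)) hρc b hWb supp Λ
  refine ⟨fun _ => mul_nonneg hM0 hE0, fun y σ τ hστ => ?_⟩
  by_cases hy : y ∈ Λ
  · -- inside link: the kernel does not see `σ_y`
    have hglue : ∀ ζ : ↥Λ → Matrix.specialUnitaryGroup (Fin N) ℂ, glueWith Λ ζ σ = glueWith Λ ζ τ :=
      fun ζ => funext fun z => by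
        by_cases hzy : z = y
        · subst hzy; rw [glueWith_apply_mem _ _ _ hy, glueWith_apply_mem _ _ _ hy]
        · exact glueWith_congr_of_eq_off Λ hστ ζ hzy
    rw [specAvg_perturbedYM_eq_tilted _ hρc b hWm supp Λ hFm σ,
      specAvg_perturbedYM_eq_tilted _ hρc b hWm supp Λ hFm τ]
    simp_rw [hglue]
    rw [sub_self, abs_zero]
    exact mul_nonneg (mul_nonneg hM0 hE0) (suFrobDist_nonneg _ _)
  · -- outside link: tilt oscillation
    rw [specAvg_perturbedYM_eq_tilted _ hρc b hWm supp Λ hFm σ,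
      specAvg_perturbedYM_eq_tilted _ hρc b hWm supp Λ hFm τ]
    have hint : ∀ ζ : ↥Λ → Matrix.specialUnitaryGroup (Fin N) ℂ,
        F (glueWith Λ ζ τ) = F (glueWith Λ ζ σ) := fun ζ => hFdep fun z hz => by
      rw [glueWith_apply_mem _ _ _ hz, glueWith_apply_mem _ _ _ hz]
    simp_rw [hint]
    have hmeas : ∀ η : LGConfig d (Matrix.specialUnitaryGroup (Fin N) ℂ), Measurable
        fun ζ : ↥Λ → Matrix.specialUnitaryGroup (Fin N) ℂ =>
          perturbedEnergy (fundamentalRep (Fin N)) b W supp Λ (glueWith Λ ζ η) := fun η =>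
      hEm.comp (measurable_glueWith Λ η)
    have hbdd : ∀ η : LGConfig d (Matrix.specialUnitaryGroup (Fin N) ℂ), ∃ B', ∀ ζ : ↥Λ → _,
        |perturbedEnergy (fundamentalRep (Fin N)) b W supp Λ (glueWith Λ ζ η)| ≤ B' := fun η =>
      ⟨B, fun ζ => hB _⟩
    set ε : ℝ := (|b| * (((2 * (d - 1) : ℕ) : ℝ) * Real.sqrt N) + ℓ) * suFrobDist (σ y) (τ y) with hεdef
    have hε : ∀ ζ : ↥Λ → Matrix.specialUnitaryGroup (Fin N) ℂ,
        |perturbedEnergy (fundamentalRep (Fin N)) b W supp Λ (glueWith Λ ζ σ) -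
          perturbedEnergy (fundamentalRep (Fin N)) b W supp Λ (glueWith Λ ζ τ) - 0| ≤ ε := fun ζ => by
      rw [sub_zero]
      have h := abs_perturbedEnergy_sub_le_of_eq_off (W := W) (supp := supp) b Λ hH hy
        (U := glueWith Λ ζ σ) (V := glueWith Λ ζ τ) (fun z hz => glueWith_congr_of_eq_off Λ hστ ζ hz)
      rwa [glueWith_apply_not_mem _ _ _ hy, glueWith_apply_not_mem _ _ _ hy] at h
    have hφm : Measurable fun ζ : ↥Λ → Matrix.specialUnitaryGroup (Fin N) ℂ => F (glueWith Λ ζ σ) :=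
      hFm.comp (measurable_glueWith Λ σ)
    have hφL : ∀ a' b' : ↥Λ → Matrix.specialUnitaryGroup (Fin N) ℂ,
        |F (glueWith Λ a' σ) - F (glueWith Λ b' σ)| ≤ 2 * M := fun a' b' =>
      (abs_sub _ _).trans (by linarith [hM (glueWith Λ a' σ), hM (glueWith Λ b' σ)])
    have key := abs_integral_tilted_sub_integral_tilted_le
      (Measure.pi fun _ : ↥Λ => haarProbability (Matrix.specialUnitaryGroup (Fin N) ℂ))
      (hmeas σ) (hmeas τ) (hbdd σ) (hbdd τ) (κ := 0) hε hφm ⟨M, fun ζ => hM _⟩ hφL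
    refine key.trans ?_
    have hconv := exp_mul_sub_one_le_div_mul (k := suFrobDist (σ y) (τ y)) (K := D) (t := a)
      (suFrobDist_nonneg _ _) (suFrobDist_le _ _) hD ha0
    have e1 : 2 * ε = suFrobDist (σ y) (τ y) * a := by rw [hεdef, ha]; ring
    rw [e1]
    calc (Real.exp (suFrobDist (σ y) (τ y) * a) - 1) / 2 * (2 * M)
        = M * (Real.exp (suFrobDist (σ y) (τ y) * a) - 1) := by ring
      _ ≤ M * (suFrobDist (σ y) (τ y) / D * (Real.exp (D * a) - 1)) :=
          mul_le_mul_of_nonneg_left hconv hM0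
      _ = M * ((Real.exp (D * a) - 1) / D) * suFrobDist (σ y) (τ y) := by ring
      _ = M * E * suFrobDist (σ y) (τ y) := by rw [hEdef]

/-- At `ℓ = 0` the smoothing Lipschitz factor is the tree's `wilsonSmoothLip N d b`. -/
theorem smoothLip_zero_eq (N d : ℕ) (b : ℝ) :
    (Real.exp (2 * Real.sqrt N * (2 * (((2 * (d - 1) : ℕ) : ℝ) * (|b| * Real.sqrt N) + 0))) - 1) /
        (2 * Real.sqrt N) = wilsonSmoothLip N d b := by
  rw [add_zero]; rfl

/-- The smoothing Lipschitz factor is non-negative and monotone in `ℓ`. -/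
theorem smoothLip_nonneg_mono (hN : 1 ≤ N) (d : ℕ) (b : ℝ) {ℓ ℓ' : ℝ} (hℓ : 0 ≤ ℓ) (hℓℓ' : ℓ ≤ ℓ') :
    0 ≤ (Real.exp (2 * Real.sqrt N * (2 * (((2 * (d - 1) : ℕ) : ℝ) * (|b| * Real.sqrt N) + ℓ))) - 1) /
        (2 * Real.sqrt N) ∧
      (Real.exp (2 * Real.sqrt N * (2 * (((2 * (d - 1) : ℕ) : ℝ) * (|b| * Real.sqrt N) + ℓ))) - 1) /
          (2 * Real.sqrt N) ≤
        (Real.exp (2 * Real.sqrt N * (2 * (((2 * (d - 1) : ℕ) : ℝ) * (|b| * Real.sqrt N) + ℓ'))) - 1) /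
          (2 * Real.sqrt N) := by
  have hN0 : (0 : ℝ) < N := by exact_mod_cast hN
  have hD : (0 : ℝ) < 2 * Real.sqrt N := by positivity
  refine ⟨div_nonneg (sub_nonneg.2 (Real.one_le_exp (by positivity))) hD.le, ?_⟩
  refine div_le_div_of_nonneg_right (sub_le_sub_right (Real.exp_le_exp.2 ?_) _) hD.le
  gcongr

/-- **Joint Lipschitz bound of the member's smoothing in the entry metric** on the `W`-collar
`T = Λ ∪ ⋃_{e ∈ Λ} perturbedNbr supp e`:
`|γ^W_Λ F(U) − γ^W_Λ F(V)| ≤ #T · N · (M · E) · dist((U_e)_{e ∈ T}, (V_e)_{e ∈ T})`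
(Föllmer's interpolation over the links of `T`, then `‖·‖_F ≤ N · entry distance`). -/
theorem abs_specAvg_perturbedYM_sub_le_mul_dist (hN : 1 ≤ N) (b : ℝ) (hWm : ∀ X, Measurable (W X))
    (hWb : ∀ X, ∃ C, ∀ U, |W X U| ≤ C) (hWdep : ∀ X, DependsOn (W X) (↑X : Set (ZdEdge d)))
    (hsupp : W.IsSupportedBy supp) (Λ : Finset (ZdEdge d)) {ℓ : ℝ} (hℓ : 0 ≤ ℓ)
    (hH : ∀ y, y ∉ Λ → ∀ U V : LGConfig d (Matrix.specialUnitaryGroup (Fin N) ℂ),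
      (∀ z, z ≠ y → U z = V z) →
        |hamiltonianIn W supp Λ U - hamiltonianIn W supp Λ V| ≤ ℓ * suFrobDist (U y) (V y))
    {F : LGConfig d (Matrix.specialUnitaryGroup (Fin N) ℂ) → ℝ} (hFm : Measurable F)
    (hFdep : DependsOn F (↑Λ : Set (ZdEdge d))) {M : ℝ} (hM : ∀ U, |F U| ≤ M)
    (U V : LGConfig d (Matrix.specialUnitaryGroup (Fin N) ℂ)) :
    |specAvg (perturbedYM (fundamentalRep (Fin N)) b W supp) Λ F U -
        specAvg (perturbedYM (fundamentalRep (Fin N)) b W supp) Λ F V| ≤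
      ((Λ ∪ Λ.biUnion (perturbedNbr supp)).card : ℝ) * N *
        (M * ((Real.exp (2 * Real.sqrt N *
          (2 * (((2 * (d - 1) : ℕ) : ℝ) * (|b| * Real.sqrt N) + ℓ))) - 1) / (2 * Real.sqrt N))) *
        dist (fun e : ↥(Λ ∪ Λ.biUnion (perturbedNbr supp)) => suEntries (U e))
          (fun e : ↥(Λ ∪ Λ.biUnion (perturbedNbr supp)) => suEntries (V e)) := by
  classical
  haveI : SecondCountableTopology (Matrix (Fin N) (Fin N) ℂ) :=
    inferInstanceAs (SecondCountableTopology (Fin N → Fin N → ℂ))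
  haveI : SecondCountableTopology (Matrix.specialUnitaryGroup (Fin N) ℂ) :=
    Topology.IsEmbedding.subtypeVal.secondCountableTopology
  set T := Λ ∪ Λ.biUnion (perturbedNbr supp) with hT
  set E : ℝ := (Real.exp (2 * Real.sqrt N *
    (2 * (((2 * (d - 1) : ℕ) : ℝ) * (|b| * Real.sqrt N) + ℓ))) - 1) / (2 * Real.sqrt N) with hE
  set f := specAvg (perturbedYM (fundamentalRep (Fin N)) b W supp) Λ F with hf
  have hdep : DependsOn f (↑T : Set (ZdEdge d)) := by
    rw [hf, hT]
    exact dependsOn_specAvg_perturbedYM_collar (fundamentalRep (Fin N)) (continuous_fundamentalRep (Fin N))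
      b hWm hWdep hsupp Λ hFm hFdep
  have hlip := isLipBound_specAvg_perturbedYM (d := d) (supp := supp) hN b hWm hWb Λ hℓ hH hFm hFdep hM
  have hM0 : 0 ≤ M := (abs_nonneg _).trans (hM fun _ => 1)
  have hE0 : 0 ≤ E := (smoothLip_nonneg_mono hN d b hℓ le_rfl).1
  have hME : 0 ≤ M * E := mul_nonneg hM0 hE0
  set δ : ℝ := dist (fun e : ↥T => suEntries (U e)) (fun e : ↥T => suEntries (V e)) with hδ
  have hδ0 : 0 ≤ δ := dist_nonneg
  have hcoord : ∀ y ∈ T, suFrobDist (U y) (V y) ≤ (N : ℝ) * δ := fun y hy => by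
    refine (suFrobDist_le_mul_dist_suEntries (U y) (V y)).trans ?_
    refine mul_le_mul_of_nonneg_left ?_ (Nat.cast_nonneg _)
    exact dist_le_pi_dist (fun e : ↥T => suEntries (U e)) (fun e : ↥T => suEntries (V e)) ⟨y, hy⟩
  calc |f U - f V| ≤ ∑ y ∈ T, M * E * suFrobDist (U y) (V y) :=
        abs_sub_le_sum_of_dependsOn hdep hlip U V
    _ ≤ ∑ _y ∈ T, M * E * ((N : ℝ) * δ) :=
        Finset.sum_le_sum fun y hy => mul_le_mul_of_nonneg_left (hcoord y hy) hME
    _ = (T.card : ℝ) * N * (M * E) * δ := by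
        rw [Finset.sum_const, nsmul_eq_mul]; ring

/-- **The member's `ℤ^d` smoothing of a bounded measurable local observable is a LIPSCHITZ CYLINDER
FUNCTION** on the `W`-collar `T = Λ ∪ ⋃_{e ∈ Λ} perturbedNbr supp e`, with constant `#T · N · M · E`
(`SU(N)`, fundamental representation, every `d`, every tree coupling `b`). -/
theorem isLipschitzCylinder_specAvg_perturbedYM (hN : 1 ≤ N) (b : ℝ) (hWm : ∀ X, Measurable (W X))
    (hWb : ∀ X, ∃ C, ∀ U, |W X U| ≤ C) (hWdep : ∀ X, DependsOn (W X) (↑X : Set (ZdEdge d)))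
    (hsupp : W.IsSupportedBy supp) (Λ : Finset (ZdEdge d)) {ℓ : ℝ} (hℓ : 0 ≤ ℓ)
    (hH : ∀ y, y ∉ Λ → ∀ U V : LGConfig d (Matrix.specialUnitaryGroup (Fin N) ℂ),
      (∀ z, z ≠ y → U z = V z) →
        |hamiltonianIn W supp Λ U - hamiltonianIn W supp Λ V| ≤ ℓ * suFrobDist (U y) (V y))
    {F : LGConfig d (Matrix.specialUnitaryGroup (Fin N) ℂ) → ℝ} (hFm : Measurable F)
    (hFdep : DependsOn F (↑Λ : Set (ZdEdge d))) {M : ℝ} (hM : ∀ U, |F U| ≤ M) :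
    IsLipschitzCylinder (fundamentalRep (Fin N))
      (specAvg (perturbedYM (fundamentalRep (Fin N)) b W supp) Λ F)
      (Λ ∪ Λ.biUnion (perturbedNbr supp))
      ((((Λ ∪ Λ.biUnion (perturbedNbr supp)).card : ℝ) * N *
        (M * ((Real.exp (2 * Real.sqrt N *
          (2 * (((2 * (d - 1) : ℕ) : ℝ) * (|b| * Real.sqrt N) + ℓ))) - 1) / (2 * Real.sqrt N)))).toNNReal) := by
  refine isLipschitzCylinder_of_dist_le fun U V => ?_
  have h := abs_specAvg_perturbedYM_sub_le_mul_dist (d := d) hN b hWm hWb hWdep hsupp Λ hℓ hH hFm hFdep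
    hM U V
  have hM0 : 0 ≤ M := (abs_nonneg _).trans (hM fun _ => 1)
  have hnn : 0 ≤ (((Λ ∪ Λ.biUnion (perturbedNbr supp)).card : ℝ) * N *
      (M * ((Real.exp (2 * Real.sqrt N *
        (2 * (((2 * (d - 1) : ℕ) : ℝ) * (|b| * Real.sqrt N) + ℓ))) - 1) / (2 * Real.sqrt N)))) :=
    mul_nonneg (mul_nonneg (Nat.cast_nonneg _) (Nat.cast_nonneg _))
      (mul_nonneg hM0 (smoothLip_nonneg_mono hN d b hℓ le_rfl).1)
  rwa [Real.coe_toNNReal _ hnn]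

/-- **Uniform form** (support size and a bound `m` on the one-link ranges only): the same conclusion with
the constant `(1 + m) · n · N · M · E`, `#Λ ≤ n`, `#(perturbedNbr supp e) ≤ m` for all `e`
(`card_union_biUnion_perturbedNbr_le`) — the form used for translated observables. -/
theorem isLipschitzCylinder_specAvg_perturbedYM_card (hN : 1 ≤ N) (b : ℝ) (hWm : ∀ X, Measurable (W X))
    (hWb : ∀ X, ∃ C, ∀ U, |W X U| ≤ C) (hWdep : ∀ X, DependsOn (W X) (↑X : Set (ZdEdge d)))
    (hsupp : W.IsSupportedBy supp) (Λ : Finset (ZdEdge d)) {ℓ : ℝ} (hℓ : 0 ≤ ℓ)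
    (hH : ∀ y, y ∉ Λ → ∀ U V : LGConfig d (Matrix.specialUnitaryGroup (Fin N) ℂ),
      (∀ z, z ≠ y → U z = V z) →
        |hamiltonianIn W supp Λ U - hamiltonianIn W supp Λ V| ≤ ℓ * suFrobDist (U y) (V y))
    {F : LGConfig d (Matrix.specialUnitaryGroup (Fin N) ℂ) → ℝ} (hFm : Measurable F)
    (hFdep : DependsOn F (↑Λ : Set (ZdEdge d))) {M : ℝ} (hM : ∀ U, |F U| ≤ M)
    {m : ℕ} (hm : ∀ e, (perturbedNbr supp e).card ≤ m) {n : ℕ} (hn : Λ.card ≤ n) :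
    IsLipschitzCylinder (fundamentalRep (Fin N))
      (specAvg (perturbedYM (fundamentalRep (Fin N)) b W supp) Λ F)
      (Λ ∪ Λ.biUnion (perturbedNbr supp))
      (((((1 + m) * n : ℕ) : ℝ) * N *
        (M * ((Real.exp (2 * Real.sqrt N *
          (2 * (((2 * (d - 1) : ℕ) : ℝ) * (|b| * Real.sqrt N) + ℓ))) - 1) / (2 * Real.sqrt N)))).toNNReal) := by
  refine isLipschitzCylinder_mono
    (isLipschitzCylinder_specAvg_perturbedYM hN b hWm hWb hWdep hsupp Λ hℓ hH hFm hFdep hM) ?_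
  have hM0 : 0 ≤ M := (abs_nonneg _).trans (hM fun _ => 1)
  have hME : 0 ≤ M * ((Real.exp (2 * Real.sqrt N *
      (2 * (((2 * (d - 1) : ℕ) : ℝ) * (|b| * Real.sqrt N) + ℓ))) - 1) / (2 * Real.sqrt N)) :=
    mul_nonneg hM0 (smoothLip_nonneg_mono hN d b hℓ le_rfl).1
  refine Real.toNNReal_le_toNNReal ?_
  refine mul_le_mul_of_nonneg_right (mul_le_mul_of_nonneg_right ?_ (Nat.cast_nonneg _)) hME
  exact_mod_cast (card_union_biUnion_perturbedNbr_le hm Λ).trans (Nat.mul_le_mul_left _ hn)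

end Lipschitz

end Summit.Ventures.YMGap.RobustBall

end
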